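import Literature.AlgebraicGeometry.Milne1999.LefschetzCentraliserProducts
import Literature.AlgebraicGeometry.Motives.AbelianVarietyProductDimProofs
import Literature.AlgebraicGeometry.HodgeTheory.CrossProductTopClass
import HarnessLib

/-!
# `S(A × B) = S(A) × S(B)` and `G(A × B) = G(A) ×_{𝔾_m} G(B)` for the product polarization (Milne 1999, Duke 96, §1 p. 643, Prop. 1.5, Def. 4.6, Cor. 4.7 — binary case, `ℂ`-points, read on `H¹`)

Family `hodge`, layer `Literature/AlgebraicGeometry/Milne1999`, namespace
`Literature.AlgebraicGeometry.Milne1999` (D-0022). Sequel of `Milne1999/LefschetzCentraliser`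
(`unitaryCentralizerGroup A h = S(A)(ℂ)`, `similitudeCentralizerGroup A h = G(A)(ℂ)` on `H¹(A(ℂ); ℂ)`)
and of `Milne1999/LefschetzCentraliserProducts` (`C(A × B) = C(A) × C(B)` iff
`Hom(A, B) = 0 = Hom(B, A)`: the restrictions `centralizerGroup.restrictFstHom / restrictSndHom`,
`u ↦ u_A, u_B`, and `centralizerGroup.prodMulEquiv`). Written for the cell `pub-hodgecm2` (COR-CM),
literature fan-out plan `HOME/lit/LIT-FANOUT-PLAN.md` §B-v3.2 R1 item (d) ("Cor 4.7
`L(A × B) = L(A) × L(B)` when `Hom(A, B) = 0` — CITE, optional"), PROVED on the centraliser side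
instead of cited. No named fact is introduced (D-0026); the two `def`s of groups
(`similitudeCentralizerGroupFibreProd`, the `MulEquiv`s) and `prodPolarizationClass` have bodies.

## Source read (held text `paper:doi-10-1215-s0012-7094-99-09620-5` = J. S. Milne, *Lefschetz classes on abelian varieties*, Duke Math. J. 96 (1999) 639–675), verbatim

* §1, p. 643 [corpus: paper:doi-10-1215-s0012-7094-99-09620-5 p0005 L14–L24]: "Let `A = A₁ × ⋯ × A_s`.
  Then `C(A) ⊂ C(A₁) × ⋯ × C(A_s)`, with equality holding if and only if `Hom(Aᵢ, Aⱼ) = 0` for all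
  `i, j`, `i ≠ j`. Moreover, if `Dᵢ` is an ample divisor on `Aᵢ`, `i = 1, …, s`, then
  `D = Σᵢ A₁ × ⋯ × A_{i-1} × Dᵢ × A_{i+1} × ⋯ × A_s` is an ample divisor on `A`, and the involution it
  defines on `C(A)` is the restriction of the product of the involutions on the `C(Aᵢ)` defined by
  the `Dᵢ`."
* §1, p. 644 [ibid. p0006 L16–L29]: "**The group `S(A)`.** […] `S(A)(R) = {γ ∈ C(A) ⊗_k R | γ†γ = 1}`.
  […] **Proposition 1.5.** Let `A₁, …, A_s` be a set of representatives for the simple isogeny factors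
  of `A`, so that there exists an isogeny `A₁^{r₁} × ⋯ × A_s^{r_s} → A` for some `rᵢ > 0`. Any such
  isogeny induces an isomorphism `S(A₁) × ⋯ × S(A_s) → S(A)`, which is independent of the choice of
  the isogeny. Proof. This is an immediate consequence of Proposition 1.1."
* §4, p. 659 [ibid. p0021 L10–L15, L28–L30, L35–L49]: "`G(A)(R) = {γ ∈ C(A) ⊗ R | γ†γ ∈ R^×}` […]
  **Theorem 4.4.** The map `γ ↦ (γ, γ†γ) : G(A) → GL(V(A)) × 𝔾_m` sends `G(A)` isomorphically onto
  `L(A)`. […] the kernel of `l(A)` […] equals `S(A)`. […] **Definition 4.6.** Consider a family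
  `(Gᵢ, tᵢ)_{i ∈ I}` of pairs consisting of an algebraic group `Gᵢ` over `k` and a homomorphism
  `tᵢ : Gᵢ → 𝔾_m`. We define the product `∏(Gᵢ, tᵢ)` of the family to be the pair `(G, t)` consisting
  of the largest subgroup of `∏ Gᵢ` on which the characters `(gᵢ)_{i∈I} ↦ t_{i₀}(g_{i₀})` agree and of
  the common restriction of these characters to `G`. […] **Corollary 4.7.** An isogeny
  `A → A₁^{r₁} × ⋯ × A_s^{r_s}` with the `Aᵢ` simple and pairwise nonisogenous defines an isomorphism
  `(L(A), l(A)) → ∏ᵢ (L(Aᵢ), l(Aᵢ))`"; proof, p. 660 [ibid. p0022 L7–L24]: "Let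
  `(L, l) = ∏(L(Aᵢ), l(Aᵢ))`, and consider the diagram `0 → S(A) → L(A) → 𝔾_m → 0` over
  `0 → ∏ S(Aᵢ) → L → 𝔾_m → 0`. Because two of the vertical maps are isomorphisms, so also is the
  third."
* §4, p. 658, proof of Cor. 4.2 [ibid. p0020 L45–L50]: "if `A` and `B` are abelian varieties with
  `Hom(A, B) = 0`, then […] the projection maps define an isomorphism […]. The general statement
  follows from this by induction." — the binary step formalized here.

## Lean rendering (the tree's carriers; `ℂ`-points; everything read on `H¹`)

Conventions of `Milne1999/LefschetzCentraliser`: `S(A)(ℂ) = unitaryCentralizerGroup A h_A` and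
`G(A)(ℂ) = similitudeCentralizerGroup A h_A` are the automorphisms of `H¹(A(ℂ); ℂ)` commuting with
all `φ^*` and preserving (resp. multiplying by a unit) the polarization pairing
`Q_{h_A}(x, y) = h_A^{dim A - 1} ⌣ x ⌣ y` (`Motives.polarizationPairingOne A.X h_A (A.dim - 1)`,
`∝ e_{D_A}^*`), Milne's "`γ†γ = 1`" / "`γ†γ ∈ R^×`" being rendered as in his proof of Thm. 4.4 by
"`e_D(γx, γy) = γ†γ · e_D(x, y)`". Milne's ample divisor `D = D_A × B + A × D_B` on `A × B` becomes
the **product polarization class** `prodPolarizationClass A B h_A h_B = pr_A^* h_A + pr_B^* h_B`, and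
"the involution `D` defines on `C(A)` is the restriction of the product of the involutions" becomes
the **block form of its pairing** on `H¹((A × B)(ℂ); ℂ) = pr_A^* H¹(A) ⊕ pr_B^* H¹(B)` (the tree's
block Gram matrix `Motives.polarizationPairingOne_add_map_map` / `…'` / `…_mixed`, file
`Motives/PolarizationPairingProduct`; Birkenhake–Lange §5.3): with `C₁ = C(dim A + dim B - 1, dim A - 1)`,
`C₂ = C(dim A + dim B - 1, dim A)`,

  `Q_D(pr_A^* a + pr_B^* b, pr_A^* a' + pr_B^* b') =
     C₁ · pr_A^* Q_{D_A}(a, a') ⌣ pr_B^* h_B^{dim B} + C₂ · pr_A^* h_A^{dim A} ⌣ pr_B^* Q_{D_B}(b, b')`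

(`polarizationPairingOne_prod_add_add`; blocks `polarizationPairingOne_prod_map_fst_map_fst`,
`…_map_snd_map_snd`, mixed `…_map_fst_map_snd = 0`). PROVED from it, for `u ∈ C(A × B)` (block
diagonal, `u = u_A ⊕ u_B`, previous file):

* `polarizationPairingOne_prod_apply_apply_eq_smul` — if `u_A` multiplies `Q_{D_A}` by `c` and `u_B`
  multiplies `Q_{D_B}` by the same `c`, then `u` multiplies `Q_D` by `c` (needs `dim A, dim B > 0`);
* `polarizationPairingOne_prodRestrictFst_eq_smul` / `…Snd…` — conversely, if `u` multiplies `Q_D` by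
  `c` then `u_A` multiplies `Q_{D_A}` by `c` (resp. `u_B`, `Q_{D_B}`), GIVEN the non-degeneracy
  `h_B^{dim B} ≠ 0` (resp. `h_A^{dim A} ≠ 0`) of the other factor: evaluate on `pr_A^* a, pr_A^* a'` and
  cancel the non-zero factor `pr_B^* h_B^{dim B}` of the `A`–`A` block by the tree's
  `cupProduct_map_fst_map_snd_ne_zero` (`pr_A^* z ⌣ pr_B^* w ≠ 0` for `z ≠ 0`, `w ≠ 0` top; file
  `HodgeTheory/CrossProductTopClass`). The hypotheses `lefschetzPow h (dim - 1) 2 h ≠ 0`, i.e.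
  `h^{dim} ≠ 0 ∈ H^{2 dim}`, hold for the class of every polarization (`(D^g) = g! · χ(D) > 0`); they
  replace "ample" in exactly the strength the argument uses (`e_D` non-degenerate on each factor).
* **`mem_unitaryCentralizerGroup_prod_iff`** — `u ∈ S(A × B)(ℂ) ↔ u_A ∈ S(A)(ℂ) ∧ u_B ∈ S(B)(ℂ)`;
  **`mem_similitudeCentralizerGroup_prod_iff`** — `u ∈ G(A × B)(ℂ) ↔ ∃ c ∈ ℂ^×`, `u_A` multiplies
  `Q_{D_A}` by `c` AND `u_B` multiplies `Q_{D_B}` by `c` — the fibre product condition of Def. 4.6 (the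
  multipliers `l(A)(u_A) = l(B)(u_B) = l(A × B)(u)` agree); `similitudeCentralizerGroupFibreProd A B h_A h_B`
  — Milne's product `(G(A), l) × (G(B), l)` of Def. 4.6 as a subgroup of `GL(H¹(A)) × GL(H¹(B))`.
* **`unitaryCentralizerGroup.prodMulEquiv`**: for `Hom(A, B) = 0 = Hom(B, A)` and non-degenerate
  `h_A`, `h_B`, `u ↦ (u_A, u_B)` is an isomorphism **`S(A × B)(ℂ) ≃* S(A)(ℂ) × S(B)(ℂ)`** — Prop. 1.5 /
  the `S`-row of the proof of Cor. 4.7, for `s = 2`, `r₁ = r₂ = 1`, the identity isogeny, and the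
  hypothesis in the form Milne's proof uses it (p. 658: "abelian varieties with `Hom(A, B) = 0`"; both
  `Hom`'s assumed); **`similitudeCentralizerGroup.prodMulEquiv`**:
  **`G(A × B)(ℂ) ≃* G(A)(ℂ) ×_{ℂ^×} G(B)(ℂ)`** — Cor. 4.7 with Def. 4.6 on the `G`-side of Thm. 4.4
  (`G ≅ L`; the identification with the tree's invariant-theoretic `lefschetzGroup` /
  `specialLefschetzGroup` of `Milne1999/LefschetzGroup` is Thm. 4.4 itself, the cited record
  `Milne1999_thm44_specialLefschetzGroup_one_eq_unitaryCentralizerGroup` of `LefschetzCentraliser`, not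
  used here).

## What is NOT here

* Powers and `s > 2` factors (`A → ∏ Aᵢ^{rᵢ}`, Milne: "by induction"; `C(A^r) = C(A)` diagonally),
  transport along a non-trivial isogeny, `Hom(Aᵢ, Aⱼ) = 0` from simplicity and non-isogeny, ampleness
  of `D` (only its class and the non-degeneracy of the factors are used), Thm. 4.4.

## References

* [Milne1999LefschetzClasses] J. S. Milne, Lefschetz classes on abelian varieties, Duke Math. J. 96
  (1999) 639–675: §1 pp. 643–644 (products, Prop. 1.1, `S(A)`, Prop. 1.5), §4 pp. 658–660 (proof of
  Cor. 4.2, `G(A)`, Thm. 4.4, `l(A)`, Def. 4.6, Cor. 4.7 and its proof).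
* [Milne1999] J. S. Milne, Lefschetz motives and the Tate conjecture, Compositio Math. 117 (1999)
  47–81: §1 p. 52 (`L(A)(R) = {(γ, c) | γ†γ = c}`).
* [LangeBirkenhake1992] Ch. Birkenhake, H. Lange, Complex Abelian Varieties (1992), Lemma 1.7.4, §5.3.
* [vanGeemen1994HodgeAV] B. van Geemen, An introduction to the Hodge conjecture for abelian
  varieties, LNM 1594 (1994), Lemma 5.2 (2)–(3) (block Gram matrix of a product).
* [HatcherAT2002] A. Hatcher, Algebraic Topology (2002), §3.2 Thm. 3.16, §3.3 Thm. 3.26.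
* [FultonYoungTableaux1997] W. Fulton, Young Tableaux (1997), Appendix B §B.1 (6).
* [GortzWedhorn2020] U. Görtz, T. Wedhorn, Algebraic Geometry I (2020), Lemma 6.26 (`dim (A × B)`).
-/

noncomputable section

open CategoryTheory
open Literature.AlgebraicTopology.SingularHomology
open Literature.AlgebraicGeometry.HodgeTheory
open Literature.AlgebraicGeometry.Motives
open Literature.Geometry.Kaehler (lefschetzPow)
open Literature.AlgebraicGeometry.VanGeemen1994 (pullbackOne)

namespace Literature.AlgebraicGeometry.Milne1999

/-! ### The product polarization `D = D_A × B + A × D_B` and its pairing on `H¹(A × B)` (Milne §1 p. 643) -/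

section Pairing

variable (A B : AbelianVariety ℂ)

/-- **The product polarization class** `pr_A^* h_A + pr_B^* h_B ∈ H²((A × B)(ℂ); ℂ)` of two classes
`h_A ∈ H²(A(ℂ); ℂ)`, `h_B ∈ H²(B(ℂ); ℂ)` — the class of Milne's ample divisor
"`D = Σᵢ A₁ × ⋯ × A_{i-1} × Dᵢ × A_{i+1} × ⋯ × A_s`" for `s = 2` (§1 p. 643: "if `Dᵢ` is an ample
divisor on `Aᵢ` […] then `D` is an ample divisor on `A`"; Birkenhake–Lange §5.3, products of
polarized abelian varieties). [cite: Milne1999LefschetzClasses, §1 p. 643] [cite: LangeBirkenhake1992, §5.3] -/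
def prodPolarizationClass (hA : complexBetti A.X 2) (hB : complexBetti B.X 2) : complexBetti (A.prod B).X 2 :=
  complexBetti.map (AbelianVariety.fst A B).hom.hom.hom 2 hA + complexBetti.map (AbelianVariety.snd A B).hom.hom.hom 2 hB

variable {A B} (hA : complexBetti A.X 2) (hB : complexBetti B.X 2)

/-- `prodPolarizationClass A B h_A h_B = pr_A^* h_A + pr_B^* h_B` (definition). [cite: Milne1999LefschetzClasses, §1 p. 643] -/
theorem prodPolarizationClass_def : prodPolarizationClass A B hA hB =
    complexBetti.map (AbelianVariety.fst A B).hom.hom.hom 2 hA +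
      complexBetti.map (AbelianVariety.snd A B).hom.hom.hom 2 hB :=
  rfl

/-- `dim (A × B) - 1 = (dim A - 1) + (dim B - 1) + 1` for positive-dimensional `A`, `B`
(`dim (A × B) = dim A + dim B`). [cite: Milne1999LefschetzClasses, §1 p. 643 (A = A₁ × A₂)] [cite: GortzWedhorn2020, Lemma 6.26] -/
theorem prod_dim_sub_one (hA0 : 0 < A.dim) (hB0 : 0 < B.dim) :
    (A.prod B).dim - 1 = (A.dim - 1) + (B.dim - 1) + 1 := by
  rw [AbelianVariety.dim_prod]; omega

/-- The top degree of `A × B` splits: `(2 + 2(dim A - 1)) + (2 + 2(dim B - 1)) = 2 + 2(dim (A × B) - 1)`.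
[cite: Milne1999LefschetzClasses, §1 p. 643 (A = A₁ × A₂)] [cite: GortzWedhorn2020, Lemma 6.26] -/
theorem prod_topDeg_eq (hA0 : 0 < A.dim) (hB0 : 0 < B.dim) :
    (2 + 2 * (A.dim - 1)) + (2 + 2 * (B.dim - 1)) = 2 + 2 * ((A.prod B).dim - 1) := by
  rw [AbelianVariety.dim_prod]; omega

/-- **The `A`–`A` block of the polarization pairing of `D = D_A × B + A × D_B`**: for `a, a' ∈ H¹(A(ℂ))`,
`Q_D(pr_A^* a, pr_A^* a') = C(dim A + dim B - 1, dim A - 1) · pr_A^*(Q_{D_A}(a, a')) ⌣ pr_B^*(h_B^{dim B})`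
(the tree's block Gram matrix `Motives.polarizationPairingOne_add_map_map`; Milne §1 p. 643: "the
involution `D` defines on `C(A)` is the restriction of the product of the involutions on the `C(Aᵢ)`
defined by the `Dᵢ`"; Birkenhake–Lange §5.3). [cite: Milne1999LefschetzClasses, §1 p. 643]
[cite: vanGeemen1994HodgeAV, Lemma 5.2 (2)–(3)] -/
theorem polarizationPairingOne_prod_map_fst_map_fst (hA0 : 0 < A.dim) (hB0 : 0 < B.dim)
    (a a' : complexBetti A.X 1) :
    polarizationPairingOne (A.prod B).X (prodPolarizationClass A B hA hB) ((A.prod B).dim - 1)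
        (complexBetti.map (AbelianVariety.fst A B).hom.hom.hom 1 a)
        (complexBetti.map (AbelianVariety.fst A B).hom.hom.hom 1 a') =
      ((((A.prod B).dim - 1).choose (A.dim - 1) : ℕ) : ℂ) • cupProduct (prod_topDeg_eq hA0 hB0)
        (complexBetti.map (AbelianVariety.fst A B).hom.hom.hom (2 + 2 * (A.dim - 1))
          (polarizationPairingOne A.X hA (A.dim - 1) a a'))
        (complexBetti.map (AbelianVariety.snd A B).hom.hom.hom (2 + 2 * (B.dim - 1))
          (lefschetzPow hB (B.dim - 1) 2 hB)) :=
  polarizationPairingOne_add_map_map _ _ (isSmoothProjective_of_dim_eq' (by omega : A.dim = A.dim - 1 + 1))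
    (isSmoothProjective_of_dim_eq' (by omega : B.dim = B.dim - 1 + 1)) hA hB (prod_dim_sub_one hA0 hB0) a a'

/-- **The `B`–`B` block**: for `b, b' ∈ H¹(B(ℂ))`,
`Q_D(pr_B^* b, pr_B^* b') = C(dim A + dim B - 1, dim A) · pr_A^*(h_A^{dim A}) ⌣ pr_B^*(Q_{D_B}(b, b'))`.
[cite: Milne1999LefschetzClasses, §1 p. 643] [cite: vanGeemen1994HodgeAV, Lemma 5.2 (2)–(3)] -/
theorem polarizationPairingOne_prod_map_snd_map_snd (hA0 : 0 < A.dim) (hB0 : 0 < B.dim)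
    (b b' : complexBetti B.X 1) :
    polarizationPairingOne (A.prod B).X (prodPolarizationClass A B hA hB) ((A.prod B).dim - 1)
        (complexBetti.map (AbelianVariety.snd A B).hom.hom.hom 1 b)
        (complexBetti.map (AbelianVariety.snd A B).hom.hom.hom 1 b') =
      ((((A.prod B).dim - 1).choose (A.dim - 1 + 1) : ℕ) : ℂ) • cupProduct (prod_topDeg_eq hA0 hB0)
        (complexBetti.map (AbelianVariety.fst A B).hom.hom.hom (2 + 2 * (A.dim - 1))
          (lefschetzPow hA (A.dim - 1) 2 hA))
        (complexBetti.map (AbelianVariety.snd A B).hom.hom.hom (2 + 2 * (B.dim - 1))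
          (polarizationPairingOne B.X hB (B.dim - 1) b b')) :=
  polarizationPairingOne_add_map_map' _ _ (isSmoothProjective_of_dim_eq' (by omega : A.dim = A.dim - 1 + 1))
    (isSmoothProjective_of_dim_eq' (by omega : B.dim = B.dim - 1 + 1)) hA hB (prod_dim_sub_one hA0 hB0) b b'

/-- **The mixed blocks vanish**: `Q_D(pr_A^* a, pr_B^* b) = 0`. [cite: Milne1999LefschetzClasses, §1 p. 643]
[cite: vanGeemen1994HodgeAV, Lemma 5.2 (2)–(3)] -/
theorem polarizationPairingOne_prod_map_fst_map_snd (hA0 : 0 < A.dim) (hB0 : 0 < B.dim)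
    (a : complexBetti A.X 1) (b : complexBetti B.X 1) :
    polarizationPairingOne (A.prod B).X (prodPolarizationClass A B hA hB) ((A.prod B).dim - 1)
        (complexBetti.map (AbelianVariety.fst A B).hom.hom.hom 1 a)
        (complexBetti.map (AbelianVariety.snd A B).hom.hom.hom 1 b) = 0 :=
  polarizationPairingOne_add_map_map_mixed _ _ (isSmoothProjective_of_dim_eq' (by omega : A.dim = A.dim - 1 + 1))
    (isSmoothProjective_of_dim_eq' (by omega : B.dim = B.dim - 1 + 1)) hA hB (prod_dim_sub_one hA0 hB0) a b

/-- The mixed blocks vanish (other order): `Q_D(pr_B^* b, pr_A^* a) = 0`. [cite: Milne1999LefschetzClasses, §1 p. 643]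
[cite: vanGeemen1994HodgeAV, Lemma 5.2 (2)–(3)] -/
theorem polarizationPairingOne_prod_map_snd_map_fst (hA0 : 0 < A.dim) (hB0 : 0 < B.dim)
    (a : complexBetti A.X 1) (b : complexBetti B.X 1) :
    polarizationPairingOne (A.prod B).X (prodPolarizationClass A B hA hB) ((A.prod B).dim - 1)
        (complexBetti.map (AbelianVariety.snd A B).hom.hom.hom 1 b)
        (complexBetti.map (AbelianVariety.fst A B).hom.hom.hom 1 a) = 0 :=
  polarizationPairingOne_add_map_map_mixed' _ _ (isSmoothProjective_of_dim_eq' (by omega : A.dim = A.dim - 1 + 1))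
    (isSmoothProjective_of_dim_eq' (by omega : B.dim = B.dim - 1 + 1)) hA hB (prod_dim_sub_one hA0 hB0) a b

/-- **The polarization pairing of `D` on `H¹(A × B) = pr_A^* H¹(A) ⊕ pr_B^* H¹(B)` is the weighted
orthogonal sum of the pairings of the factors**:
`Q_D(pr_A^* a + pr_B^* b, pr_A^* a' + pr_B^* b') = C₁ · pr_A^* Q_{D_A}(a, a') ⌣ pr_B^* h_B^{dim B} +
C₂ · pr_A^* h_A^{dim A} ⌣ pr_B^* Q_{D_B}(b, b')` (Milne §1 p. 643, the involution of `D` on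
`C(A₁) × C(A₂)`; Birkenhake–Lange §5.3). [cite: Milne1999LefschetzClasses, §1 p. 643] [cite: LangeBirkenhake1992, §5.3] -/
theorem polarizationPairingOne_prod_add_add (hA0 : 0 < A.dim) (hB0 : 0 < B.dim)
    (a a' : complexBetti A.X 1) (b b' : complexBetti B.X 1) :
    polarizationPairingOne (A.prod B).X (prodPolarizationClass A B hA hB) ((A.prod B).dim - 1)
        (complexBetti.map (AbelianVariety.fst A B).hom.hom.hom 1 a +
          complexBetti.map (AbelianVariety.snd A B).hom.hom.hom 1 b)
        (complexBetti.map (AbelianVariety.fst A B).hom.hom.hom 1 a' +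
          complexBetti.map (AbelianVariety.snd A B).hom.hom.hom 1 b') =
      ((((A.prod B).dim - 1).choose (A.dim - 1) : ℕ) : ℂ) • cupProduct (prod_topDeg_eq hA0 hB0)
          (complexBetti.map (AbelianVariety.fst A B).hom.hom.hom (2 + 2 * (A.dim - 1))
            (polarizationPairingOne A.X hA (A.dim - 1) a a'))
          (complexBetti.map (AbelianVariety.snd A B).hom.hom.hom (2 + 2 * (B.dim - 1))
            (lefschetzPow hB (B.dim - 1) 2 hB)) +
        ((((A.prod B).dim - 1).choose (A.dim - 1 + 1) : ℕ) : ℂ) • cupProduct (prod_topDeg_eq hA0 hB0)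
          (complexBetti.map (AbelianVariety.fst A B).hom.hom.hom (2 + 2 * (A.dim - 1))
            (lefschetzPow hA (A.dim - 1) 2 hA))
          (complexBetti.map (AbelianVariety.snd A B).hom.hom.hom (2 + 2 * (B.dim - 1))
            (polarizationPairingOne B.X hB (B.dim - 1) b b')) := by
  rw [LinearMap.map_add₂, map_add, map_add, polarizationPairingOne_prod_map_fst_map_fst hA hB hA0 hB0,
    polarizationPairingOne_prod_map_fst_map_snd hA hB hA0 hB0, polarizationPairingOne_prod_map_snd_map_fst hA hB hA0 hB0,
    polarizationPairingOne_prod_map_snd_map_snd hA hB hA0 hB0, add_zero, zero_add]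

variable {u : complexBetti (A.prod B).X 1 ≃ₗ[ℂ] complexBetti (A.prod B).X 1}

/-- **The pairing of `D` after an element `u ∈ C(A × B)`** (block diagonal, `u = u_A ⊕ u_B`):
`Q_D(u x, u y) = C₁ · pr_A^* Q_{D_A}(u_A x_A, u_A y_A) ⌣ pr_B^* h_B^{dim B} + C₂ · pr_A^* h_A^{dim A} ⌣
pr_B^* Q_{D_B}(u_B x_B, u_B y_B)`, `x_A = (𝟙,0)^* x`, `x_B = (0,𝟙)^* x`. [cite: Milne1999LefschetzClasses, §1 p. 643] -/
theorem polarizationPairingOne_prod_apply_apply (hA0 : 0 < A.dim) (hB0 : 0 < B.dim)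
    (hu : u ∈ centralizerGroup (A.prod B)) (x y : complexBetti (A.prod B).X 1) :
    polarizationPairingOne (A.prod B).X (prodPolarizationClass A B hA hB) ((A.prod B).dim - 1) (u x) (u y) =
      ((((A.prod B).dim - 1).choose (A.dim - 1) : ℕ) : ℂ) • cupProduct (prod_topDeg_eq hA0 hB0)
          (complexBetti.map (AbelianVariety.fst A B).hom.hom.hom (2 + 2 * (A.dim - 1))
            (polarizationPairingOne A.X hA (A.dim - 1)
              (prodRestrictFst u.toLinearMap
                (complexBetti.map (AbelianVariety.prodLift (𝟙 A) (0 : A ⟶ B)).hom.hom.hom 1 x))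
              (prodRestrictFst u.toLinearMap
                (complexBetti.map (AbelianVariety.prodLift (𝟙 A) (0 : A ⟶ B)).hom.hom.hom 1 y))))
          (complexBetti.map (AbelianVariety.snd A B).hom.hom.hom (2 + 2 * (B.dim - 1))
            (lefschetzPow hB (B.dim - 1) 2 hB)) +
        ((((A.prod B).dim - 1).choose (A.dim - 1 + 1) : ℕ) : ℂ) • cupProduct (prod_topDeg_eq hA0 hB0)
          (complexBetti.map (AbelianVariety.fst A B).hom.hom.hom (2 + 2 * (A.dim - 1))
            (lefschetzPow hA (A.dim - 1) 2 hA))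
          (complexBetti.map (AbelianVariety.snd A B).hom.hom.hom (2 + 2 * (B.dim - 1))
            (polarizationPairingOne B.X hB (B.dim - 1)
              (prodRestrictSnd u.toLinearMap
                (complexBetti.map (AbelianVariety.prodLift (0 : B ⟶ A) (𝟙 B)).hom.hom.hom 1 x))
              (prodRestrictSnd u.toLinearMap
                (complexBetti.map (AbelianVariety.prodLift (0 : B ⟶ A) (𝟙 B)).hom.hom.hom 1 y)))) := by
  have hux : ∀ z : complexBetti (A.prod B).X 1, u z =
      complexBetti.map (AbelianVariety.fst A B).hom.hom.hom 1 (prodRestrictFst u.toLinearMap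
          (complexBetti.map (AbelianVariety.prodLift (𝟙 A) (0 : A ⟶ B)).hom.hom.hom 1 z)) +
        complexBetti.map (AbelianVariety.snd A B).hom.hom.hom 1 (prodRestrictSnd u.toLinearMap
          (complexBetti.map (AbelianVariety.prodLift (0 : B ⟶ A) (𝟙 B)).hom.hom.hom 1 z)) := fun z ↦ by
    conv_lhs => rw [eq_map_fst_add_map_snd_one z]
    rw [map_add, apply_map_fst_of_mem_centralizerGroup hu, apply_map_snd_of_mem_centralizerGroup hu]
  rw [hux x, hux y]
  exact polarizationPairingOne_prod_add_add hA hB hA0 hB0 _ _ _ _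

/-- The pairing of `D` on arbitrary classes, through the Künneth components:
`Q_D(x, y) = C₁ · pr_A^* Q_{D_A}(x_A, y_A) ⌣ pr_B^* h_B^{dim B} + C₂ · pr_A^* h_A^{dim A} ⌣ pr_B^* Q_{D_B}(x_B, y_B)`.
[cite: Milne1999LefschetzClasses, §1 p. 643] -/
theorem polarizationPairingOne_prod_eq (hA0 : 0 < A.dim) (hB0 : 0 < B.dim) (x y : complexBetti (A.prod B).X 1) :
    polarizationPairingOne (A.prod B).X (prodPolarizationClass A B hA hB) ((A.prod B).dim - 1) x y =
      ((((A.prod B).dim - 1).choose (A.dim - 1) : ℕ) : ℂ) • cupProduct (prod_topDeg_eq hA0 hB0)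
          (complexBetti.map (AbelianVariety.fst A B).hom.hom.hom (2 + 2 * (A.dim - 1))
            (polarizationPairingOne A.X hA (A.dim - 1)
              (complexBetti.map (AbelianVariety.prodLift (𝟙 A) (0 : A ⟶ B)).hom.hom.hom 1 x)
              (complexBetti.map (AbelianVariety.prodLift (𝟙 A) (0 : A ⟶ B)).hom.hom.hom 1 y)))
          (complexBetti.map (AbelianVariety.snd A B).hom.hom.hom (2 + 2 * (B.dim - 1))
            (lefschetzPow hB (B.dim - 1) 2 hB)) +
        ((((A.prod B).dim - 1).choose (A.dim - 1 + 1) : ℕ) : ℂ) • cupProduct (prod_topDeg_eq hA0 hB0)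
          (complexBetti.map (AbelianVariety.fst A B).hom.hom.hom (2 + 2 * (A.dim - 1))
            (lefschetzPow hA (A.dim - 1) 2 hA))
          (complexBetti.map (AbelianVariety.snd A B).hom.hom.hom (2 + 2 * (B.dim - 1))
            (polarizationPairingOne B.X hB (B.dim - 1)
              (complexBetti.map (AbelianVariety.prodLift (0 : B ⟶ A) (𝟙 B)).hom.hom.hom 1 x)
              (complexBetti.map (AbelianVariety.prodLift (0 : B ⟶ A) (𝟙 B)).hom.hom.hom 1 y))) := by
  conv_lhs => rw [eq_map_fst_add_map_snd_one x, eq_map_fst_add_map_snd_one y]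
  exact polarizationPairingOne_prod_add_add hA hB hA0 hB0 _ _ _ _

/-- **If `u_A` multiplies `Q_{D_A}` by `c` and `u_B` multiplies `Q_{D_B}` by the same `c`, then
`u = u_A ⊕ u_B ∈ C(A × B)` multiplies `Q_D` by `c`** — the inclusion
`G(A₁) ×_{𝔾_m} G(A₂) ⊆ G(A₁ × A₂)` / `S(A₁) × S(A₂) ⊆ S(A₁ × A₂)` of Milne Prop. 1.5 / Def. 4.6 /
Cor. 4.7 on `ℂ`-points, read on `H¹`. [cite: Milne1999LefschetzClasses, §1 p. 643, Prop. 1.5 and Cor. 4.7] -/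
theorem polarizationPairingOne_prod_apply_apply_eq_smul (hA0 : 0 < A.dim) (hB0 : 0 < B.dim)
    (hu : u ∈ centralizerGroup (A.prod B)) (c : ℂ)
    (hcA : ∀ a a' : complexBetti A.X 1, polarizationPairingOne A.X hA (A.dim - 1)
      (prodRestrictFst u.toLinearMap a) (prodRestrictFst u.toLinearMap a') =
        c • polarizationPairingOne A.X hA (A.dim - 1) a a')
    (hcB : ∀ b b' : complexBetti B.X 1, polarizationPairingOne B.X hB (B.dim - 1)
      (prodRestrictSnd u.toLinearMap b) (prodRestrictSnd u.toLinearMap b') =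
        c • polarizationPairingOne B.X hB (B.dim - 1) b b')
    (x y : complexBetti (A.prod B).X 1) :
    polarizationPairingOne (A.prod B).X (prodPolarizationClass A B hA hB) ((A.prod B).dim - 1) (u x) (u y) =
      c • polarizationPairingOne (A.prod B).X (prodPolarizationClass A B hA hB) ((A.prod B).dim - 1) x y := by
  rw [polarizationPairingOne_prod_apply_apply hA hB hA0 hB0 hu, hcA, hcB,
    polarizationPairingOne_prod_eq hA hB hA0 hB0 x y]
  simp only [map_smul, LinearMap.smul_apply, smul_add, smul_smul, mul_comm c]

/-- Positivity of the dimension from the non-vanishing of the top power `h^{dim}` (in dimension `0`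
the group `H²` vanishes). [cite: HatcherAT2002, §3.3 Thm. 3.26 (c)] -/
theorem dim_pos_of_lefschetzPow_ne_zero {C : AbelianVariety ℂ} {h : complexBetti C.X 2}
    (hh : lefschetzPow h (C.dim - 1) 2 h ≠ 0) : 0 < C.dim := by
  by_contra h0
  have hC : C.dim = 0 := by omega
  haveI : Subsingleton (complexBetti C.X (2 + 2 * (C.dim - 1))) :=
    subsingleton_complexBetti (AbelianVariety.isSmoothProjective_holds (A := C)) (by omega)
  exact hh (Subsingleton.elim _ _)

/-- `pr_A^* z ⌣ pr_B^* w = 0` with `w ≠ 0` of top degree on `B` forces `z = 0` (the tree's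
`cupProduct_map_fst_map_snd_ne_zero`: `pr_A^* z ⌣ pr_B^* w ≠ 0` for `z ≠ 0`, `w ≠ 0` top).
[cite: FultonYoungTableaux1997, Appendix B §B.1 (6)] -/
theorem eq_zero_of_cupProduct_map_fst_map_snd_eq_zero_left {k d n m : ℕ} (hd : d = 2 * n)
    (hBn : IsSmoothProjective n B.X) (hkm : k + d = m) {z : complexBetti A.X k} {w : complexBetti B.X d}
    (hw : w ≠ 0) (h0 : cupProduct hkm (complexBetti.map (AbelianVariety.fst A B).hom.hom.hom k z)
      (complexBetti.map (AbelianVariety.snd A B).hom.hom.hom d w) = 0) : z = 0 := by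
  subst hd
  by_contra hz
  exact cupProduct_map_fst_map_snd_ne_zero (X := A.X) (Z := B.X)
    (fun _ _ h ↦ Classical.choice (Motives.ComplexPoints.isOrientableOver ℂ h))
    (AbelianVariety.isSmoothProjective_holds (A := A)) hBn hkm hz hw h0

/-- `pr_A^* z ⌣ pr_B^* w = 0` with `z ≠ 0` and `w` of top degree on `B` forces `w = 0`.
[cite: FultonYoungTableaux1997, Appendix B §B.1 (6)] -/
theorem eq_zero_of_cupProduct_map_fst_map_snd_eq_zero_right {k d n m : ℕ} (hd : d = 2 * n)
    (hBn : IsSmoothProjective n B.X) (hkm : k + d = m) {z : complexBetti A.X k} {w : complexBetti B.X d}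
    (hz : z ≠ 0) (h0 : cupProduct hkm (complexBetti.map (AbelianVariety.fst A B).hom.hom.hom k z)
      (complexBetti.map (AbelianVariety.snd A B).hom.hom.hom d w) = 0) : w = 0 := by
  subst hd
  by_contra hw
  exact cupProduct_map_fst_map_snd_ne_zero (X := A.X) (Z := B.X)
    (fun _ _ h ↦ Classical.choice (Motives.ComplexPoints.isOrientableOver ℂ h))
    (AbelianVariety.isSmoothProjective_holds (A := A)) hBn hkm hz hw h0

/-- **If `u ∈ C(A × B)` multiplies `Q_D` by `c`, its `A`-component `u_A` multiplies `Q_{D_A}` by `c`**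
(given `h_B^{dim B} ≠ 0`, i.e. `D_B` non-degenerate): evaluate on `pr_A^* a`, `pr_A^* a'` and cancel
the non-zero factor `pr_B^* h_B^{dim B}` of the `A`–`A` block — the projection
`G(A₁ × A₂) → G(A₁)`, `S(A₁ × A₂) → S(A₁)` of Milne Prop. 1.5 / Cor. 4.7 on `ℂ`-points, read on `H¹`.
[cite: Milne1999LefschetzClasses, §1 p. 643, Prop. 1.5 and Cor. 4.7] -/
theorem polarizationPairingOne_prodRestrictFst_eq_smul (hB' : lefschetzPow hB (B.dim - 1) 2 hB ≠ 0)
    (hu : u ∈ centralizerGroup (A.prod B)) (c : ℂ)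
    (hc : ∀ x y : complexBetti (A.prod B).X 1,
      polarizationPairingOne (A.prod B).X (prodPolarizationClass A B hA hB) ((A.prod B).dim - 1) (u x) (u y) =
        c • polarizationPairingOne (A.prod B).X (prodPolarizationClass A B hA hB) ((A.prod B).dim - 1) x y)
    (a a' : complexBetti A.X 1) :
    polarizationPairingOne A.X hA (A.dim - 1) (prodRestrictFst u.toLinearMap a) (prodRestrictFst u.toLinearMap a') =
      c • polarizationPairingOne A.X hA (A.dim - 1) a a' := by
  have hB0 : 0 < B.dim := dim_pos_of_lefschetzPow_ne_zero hB'
  rcases Nat.eq_zero_or_pos A.dim with hA00 | hA0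
  · haveI : Subsingleton (complexBetti A.X (2 + 2 * (A.dim - 1))) :=
      subsingleton_complexBetti (AbelianVariety.isSmoothProjective_holds (A := A)) (by omega)
    exact Subsingleton.elim _ _
  have h := hc (complexBetti.map (AbelianVariety.fst A B).hom.hom.hom 1 a)
    (complexBetti.map (AbelianVariety.fst A B).hom.hom.hom 1 a')
  rw [apply_map_fst_of_mem_centralizerGroup hu, apply_map_fst_of_mem_centralizerGroup hu,
    polarizationPairingOne_prod_map_fst_map_fst hA hB hA0 hB0,
    polarizationPairingOne_prod_map_fst_map_fst hA hB hA0 hB0, smul_comm c, ← sub_eq_zero, ← smul_sub,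
    smul_eq_zero] at h
  rcases h with h | h
  · exact absurd h (Nat.cast_ne_zero.2 (Nat.choose_pos (by rw [prod_dim_sub_one hA0 hB0]; omega)).ne')
  have key : cupProduct (prod_topDeg_eq hA0 hB0)
      (complexBetti.map (AbelianVariety.fst A B).hom.hom.hom (2 + 2 * (A.dim - 1))
        (polarizationPairingOne A.X hA (A.dim - 1) (prodRestrictFst u.toLinearMap a) (prodRestrictFst u.toLinearMap a') -
          c • polarizationPairingOne A.X hA (A.dim - 1) a a'))
      (complexBetti.map (AbelianVariety.snd A B).hom.hom.hom (2 + 2 * (B.dim - 1))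
        (lefschetzPow hB (B.dim - 1) 2 hB)) = 0 := by
    rw [map_sub, map_smul, LinearMap.map_sub₂, LinearMap.map_smul₂]
    exact h
  exact sub_eq_zero.1 (eq_zero_of_cupProduct_map_fst_map_snd_eq_zero_left (by omega : 2 + 2 * (B.dim - 1) = 2 * B.dim)
    (AbelianVariety.isSmoothProjective_holds (A := B)) _ hB' key)

/-- **If `u ∈ C(A × B)` multiplies `Q_D` by `c`, its `B`-component `u_B` multiplies `Q_{D_B}` by `c`**
(given `h_A^{dim A} ≠ 0`). [cite: Milne1999LefschetzClasses, §1 p. 643, Prop. 1.5 and Cor. 4.7] -/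
theorem polarizationPairingOne_prodRestrictSnd_eq_smul (hA' : lefschetzPow hA (A.dim - 1) 2 hA ≠ 0)
    (hu : u ∈ centralizerGroup (A.prod B)) (c : ℂ)
    (hc : ∀ x y : complexBetti (A.prod B).X 1,
      polarizationPairingOne (A.prod B).X (prodPolarizationClass A B hA hB) ((A.prod B).dim - 1) (u x) (u y) =
        c • polarizationPairingOne (A.prod B).X (prodPolarizationClass A B hA hB) ((A.prod B).dim - 1) x y)
    (b b' : complexBetti B.X 1) :
    polarizationPairingOne B.X hB (B.dim - 1) (prodRestrictSnd u.toLinearMap b) (prodRestrictSnd u.toLinearMap b') =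
      c • polarizationPairingOne B.X hB (B.dim - 1) b b' := by
  have hA0 : 0 < A.dim := dim_pos_of_lefschetzPow_ne_zero hA'
  rcases Nat.eq_zero_or_pos B.dim with hB00 | hB0
  · haveI : Subsingleton (complexBetti B.X (2 + 2 * (B.dim - 1))) :=
      subsingleton_complexBetti (AbelianVariety.isSmoothProjective_holds (A := B)) (by omega)
    exact Subsingleton.elim _ _
  have h := hc (complexBetti.map (AbelianVariety.snd A B).hom.hom.hom 1 b)
    (complexBetti.map (AbelianVariety.snd A B).hom.hom.hom 1 b')
  rw [apply_map_snd_of_mem_centralizerGroup hu, apply_map_snd_of_mem_centralizerGroup hu,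
    polarizationPairingOne_prod_map_snd_map_snd hA hB hA0 hB0,
    polarizationPairingOne_prod_map_snd_map_snd hA hB hA0 hB0, smul_comm c, ← sub_eq_zero, ← smul_sub,
    smul_eq_zero] at h
  rcases h with h | h
  · exact absurd h (Nat.cast_ne_zero.2 (Nat.choose_pos (by rw [prod_dim_sub_one hA0 hB0]; omega)).ne')
  have key : cupProduct (prod_topDeg_eq hA0 hB0)
      (complexBetti.map (AbelianVariety.fst A B).hom.hom.hom (2 + 2 * (A.dim - 1))
        (lefschetzPow hA (A.dim - 1) 2 hA))
      (complexBetti.map (AbelianVariety.snd A B).hom.hom.hom (2 + 2 * (B.dim - 1))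
        (polarizationPairingOne B.X hB (B.dim - 1) (prodRestrictSnd u.toLinearMap b) (prodRestrictSnd u.toLinearMap b') -
          c • polarizationPairingOne B.X hB (B.dim - 1) b b')) = 0 := by
    rw [map_sub, map_smul, map_sub, map_smul]
    exact h
  exact sub_eq_zero.1 (eq_zero_of_cupProduct_map_fst_map_snd_eq_zero_right (by omega : 2 + 2 * (B.dim - 1) = 2 * B.dim)
    (AbelianVariety.isSmoothProjective_holds (A := B)) _ hA' key)

end Pairing

/-! ### `S(A × B) = S(A) × S(B)` and `G(A × B) = G(A) ×_{𝔾_m} G(B)` (Milne Prop. 1.5, Def. 4.6, Cor. 4.7 — binary case, `ℂ`-points, on `H¹`) -/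

section Groups

variable {A B : AbelianVariety ℂ} {hA : complexBetti A.X 2} {hB : complexBetti B.X 2}

/-- **`S(A × B)(ℂ) = S(A)(ℂ) × S(B)(ℂ)` elementwise** (Milne Prop. 1.5 / Cor. 4.7 with `S = ker l`,
binary case, read on `H¹`): for `u ∈ C(A × B)` and the product polarization `D = D_A × B + A × D_B`
with non-degenerate factors (`h_A^{dim A} ≠ 0`, `h_B^{dim B} ≠ 0` — true for polarizations), `u`
preserves `Q_D` iff `u_A` preserves `Q_{D_A}` and `u_B` preserves `Q_{D_B}`.
[cite: Milne1999LefschetzClasses, Prop. 1.5 and Cor. 4.7 (with p. 659: ker l(A) = S(A))] -/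
theorem mem_unitaryCentralizerGroup_prod_iff (hA' : lefschetzPow hA (A.dim - 1) 2 hA ≠ 0)
    (hB' : lefschetzPow hB (B.dim - 1) 2 hB ≠ 0) (u : centralizerGroup (A.prod B)) :
    (u : complexBetti (A.prod B).X 1 ≃ₗ[ℂ] complexBetti (A.prod B).X 1) ∈
        unitaryCentralizerGroup (A.prod B) (prodPolarizationClass A B hA hB) ↔
      centralizerGroup.restrictFstHom A B u ∈ unitaryCentralizerGroup A hA ∧
        centralizerGroup.restrictSndHom A B u ∈ unitaryCentralizerGroup B hB := by
  have hA0 := dim_pos_of_lefschetzPow_ne_zero hA'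
  have hB0 := dim_pos_of_lefschetzPow_ne_zero hB'
  constructor
  · rintro ⟨-, hQ⟩
    have hQ' : ∀ x y : complexBetti (A.prod B).X 1,
        polarizationPairingOne (A.prod B).X (prodPolarizationClass A B hA hB) ((A.prod B).dim - 1)
          ((u : complexBetti (A.prod B).X 1 ≃ₗ[ℂ] _) x) ((u : complexBetti (A.prod B).X 1 ≃ₗ[ℂ] _) y) =
        (1 : ℂ) • polarizationPairingOne (A.prod B).X (prodPolarizationClass A B hA hB) ((A.prod B).dim - 1) x y :=
      fun x y ↦ by rw [one_smul]; exact hQ x y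
    refine ⟨⟨centralizerGroup.restrictFstHom_mem u, fun a a' ↦ ?_⟩,
      ⟨centralizerGroup.restrictSndHom_mem u, fun b b' ↦ ?_⟩⟩
    · have h := polarizationPairingOne_prodRestrictFst_eq_smul hA hB hB' u.2 1 hQ' a a'
      rw [one_smul] at h
      exact h
    · have h := polarizationPairingOne_prodRestrictSnd_eq_smul hA hB hA' u.2 1 hQ' b b'
      rw [one_smul] at h
      exact h
  · rintro ⟨⟨-, hQA⟩, ⟨-, hQB⟩⟩
    refine ⟨u.2, fun x y ↦ ?_⟩
    have h := polarizationPairingOne_prod_apply_apply_eq_smul hA hB hA0 hB0 u.2 1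
      (fun a a' ↦ by rw [one_smul]; exact hQA a a') (fun b b' ↦ by rw [one_smul]; exact hQB b b') x y
    rwa [one_smul] at h

/-- **`G(A × B)(ℂ) = G(A)(ℂ) ×_{ℂ^×} G(B)(ℂ)` elementwise** (Milne Cor. 4.7 with the product of Def. 4.6:
"the largest subgroup of `∏ Gᵢ` on which the characters `(gᵢ) ↦ tᵢ(gᵢ)` agree"; binary case, read on
`H¹`): for `u ∈ C(A × B)`, `u` multiplies `Q_D` by a unit iff `u_A` multiplies `Q_{D_A}` and `u_B`
multiplies `Q_{D_B}` by ONE AND THE SAME unit `c` (the common value of the multipliers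
`l(A)(u_A) = l(B)(u_B) = l(A × B)(u)`). [cite: Milne1999LefschetzClasses, Def. 4.6 and Cor. 4.7] -/
theorem mem_similitudeCentralizerGroup_prod_iff (hA' : lefschetzPow hA (A.dim - 1) 2 hA ≠ 0)
    (hB' : lefschetzPow hB (B.dim - 1) 2 hB ≠ 0) (u : centralizerGroup (A.prod B)) :
    (u : complexBetti (A.prod B).X 1 ≃ₗ[ℂ] complexBetti (A.prod B).X 1) ∈
        similitudeCentralizerGroup (A.prod B) (prodPolarizationClass A B hA hB) ↔
      ∃ c : ℂˣ,
        (∀ a a' : complexBetti A.X 1, polarizationPairingOne A.X hA (A.dim - 1)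
            (centralizerGroup.restrictFstHom A B u a) (centralizerGroup.restrictFstHom A B u a') =
          (c : ℂ) • polarizationPairingOne A.X hA (A.dim - 1) a a') ∧
        (∀ b b' : complexBetti B.X 1, polarizationPairingOne B.X hB (B.dim - 1)
            (centralizerGroup.restrictSndHom A B u b) (centralizerGroup.restrictSndHom A B u b') =
          (c : ℂ) • polarizationPairingOne B.X hB (B.dim - 1) b b') := by
  have hA0 := dim_pos_of_lefschetzPow_ne_zero hA'
  have hB0 := dim_pos_of_lefschetzPow_ne_zero hB'
  constructor
  · rintro ⟨-, c, hc⟩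
    exact ⟨c, fun a a' ↦ polarizationPairingOne_prodRestrictFst_eq_smul hA hB hB' u.2 c hc a a',
      fun b b' ↦ polarizationPairingOne_prodRestrictSnd_eq_smul hA hB hA' u.2 c hc b b'⟩
  · rintro ⟨c, hcA, hcB⟩
    exact ⟨u.2, c, polarizationPairingOne_prod_apply_apply_eq_smul hA hB hA0 hB0 u.2 c hcA hcB⟩

/-- **`G(A × B) → G(A)`**: the `A`-component of `u ∈ G(A × B)(ℂ)` lies in `G(A)(ℂ)` (with the same
multiplier). [cite: Milne1999LefschetzClasses, Cor. 4.7] -/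
theorem centralizerGroup.restrictFstHom_mem_similitudeCentralizerGroup
    (hB' : lefschetzPow hB (B.dim - 1) 2 hB ≠ 0) (u : centralizerGroup (A.prod B))
    (hu : (u : complexBetti (A.prod B).X 1 ≃ₗ[ℂ] complexBetti (A.prod B).X 1) ∈
      similitudeCentralizerGroup (A.prod B) (prodPolarizationClass A B hA hB)) :
    centralizerGroup.restrictFstHom A B u ∈ similitudeCentralizerGroup A hA := by
  obtain ⟨-, c, hc⟩ := hu
  exact ⟨centralizerGroup.restrictFstHom_mem u, c,
    fun a a' ↦ polarizationPairingOne_prodRestrictFst_eq_smul hA hB hB' u.2 c hc a a'⟩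

/-- **`G(A × B) → G(B)`**: the `B`-component of `u ∈ G(A × B)(ℂ)` lies in `G(B)(ℂ)` (with the same
multiplier). [cite: Milne1999LefschetzClasses, Cor. 4.7] -/
theorem centralizerGroup.restrictSndHom_mem_similitudeCentralizerGroup
    (hA' : lefschetzPow hA (A.dim - 1) 2 hA ≠ 0) (u : centralizerGroup (A.prod B))
    (hu : (u : complexBetti (A.prod B).X 1 ≃ₗ[ℂ] complexBetti (A.prod B).X 1) ∈
      similitudeCentralizerGroup (A.prod B) (prodPolarizationClass A B hA hB)) :
    centralizerGroup.restrictSndHom A B u ∈ similitudeCentralizerGroup B hB := by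
  obtain ⟨-, c, hc⟩ := hu
  exact ⟨centralizerGroup.restrictSndHom_mem u, c,
    fun b b' ↦ polarizationPairingOne_prodRestrictSnd_eq_smul hA hB hA' u.2 c hc b b'⟩

/-- **`S(A × B) → S(A)`**: the `A`-component of `u ∈ S(A × B)(ℂ)` lies in `S(A)(ℂ)`. [cite: Milne1999LefschetzClasses, Prop. 1.5 and Cor. 4.7] -/
theorem centralizerGroup.restrictFstHom_mem_unitaryCentralizerGroup
    (hB' : lefschetzPow hB (B.dim - 1) 2 hB ≠ 0) (u : centralizerGroup (A.prod B))
    (hu : (u : complexBetti (A.prod B).X 1 ≃ₗ[ℂ] complexBetti (A.prod B).X 1) ∈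
      unitaryCentralizerGroup (A.prod B) (prodPolarizationClass A B hA hB)) :
    centralizerGroup.restrictFstHom A B u ∈ unitaryCentralizerGroup A hA := by
  refine ⟨centralizerGroup.restrictFstHom_mem u, fun a a' ↦ ?_⟩
  have h := polarizationPairingOne_prodRestrictFst_eq_smul hA hB hB' u.2 1
    (fun x y ↦ by rw [one_smul]; exact hu.2 x y) a a'
  rw [one_smul] at h
  exact h

/-- **`S(A × B) → S(B)`**: the `B`-component of `u ∈ S(A × B)(ℂ)` lies in `S(B)(ℂ)`. [cite: Milne1999LefschetzClasses, Prop. 1.5 and Cor. 4.7] -/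
theorem centralizerGroup.restrictSndHom_mem_unitaryCentralizerGroup
    (hA' : lefschetzPow hA (A.dim - 1) 2 hA ≠ 0) (u : centralizerGroup (A.prod B))
    (hu : (u : complexBetti (A.prod B).X 1 ≃ₗ[ℂ] complexBetti (A.prod B).X 1) ∈
      unitaryCentralizerGroup (A.prod B) (prodPolarizationClass A B hA hB)) :
    centralizerGroup.restrictSndHom A B u ∈ unitaryCentralizerGroup B hB := by
  refine ⟨centralizerGroup.restrictSndHom_mem u, fun b b' ↦ ?_⟩
  have h := polarizationPairingOne_prodRestrictSnd_eq_smul hA hB hA' u.2 1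
    (fun x y ↦ by rw [one_smul]; exact hu.2 x y) b b'
  rw [one_smul] at h
  exact h

variable (A B hA hB)

/-- **Milne's product `(G(A), l(A)) × (G(B), l(B))` of Def. 4.6, on `ℂ`-points and read on `H¹`**:
"the largest subgroup of `∏ Gᵢ` on which the characters `(gᵢ)_{i ∈ I} ↦ t_{i₀}(g_{i₀})` agree" — the
pairs `(s, t) ∈ C(A)^× × C(B)^×` multiplying `Q_{D_A}` and `Q_{D_B}` by a COMMON unit `c`
(the fibre product `G(A) ×_{𝔾_m} G(B)` over the multiplier characters).
[cite: Milne1999LefschetzClasses, Def. 4.6] -/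
def similitudeCentralizerGroupFibreProd :
    Subgroup ((complexBetti A.X 1 ≃ₗ[ℂ] complexBetti A.X 1) × (complexBetti B.X 1 ≃ₗ[ℂ] complexBetti B.X 1)) where
  carrier := {p | p.1 ∈ centralizerGroup A ∧ p.2 ∈ centralizerGroup B ∧ ∃ c : ℂˣ,
    (∀ a a' : complexBetti A.X 1, polarizationPairingOne A.X hA (A.dim - 1) (p.1 a) (p.1 a') =
      (c : ℂ) • polarizationPairingOne A.X hA (A.dim - 1) a a') ∧
    (∀ b b' : complexBetti B.X 1, polarizationPairingOne B.X hB (B.dim - 1) (p.2 b) (p.2 b') =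
      (c : ℂ) • polarizationPairingOne B.X hB (B.dim - 1) b b')}
  mul_mem' := by
    rintro p q ⟨hp₁, hp₂, c, hpA, hpB⟩ ⟨hq₁, hq₂, d, hqA, hqB⟩
    refine ⟨(centralizerGroup A).mul_mem hp₁ hq₁, (centralizerGroup B).mul_mem hp₂ hq₂, c * d,
      fun a a' ↦ ?_, fun b b' ↦ ?_⟩
    · rw [Prod.fst_mul, LinearEquiv.mul_apply, LinearEquiv.mul_apply, hpA, hqA, smul_smul, Units.val_mul]
    · rw [Prod.snd_mul, LinearEquiv.mul_apply, LinearEquiv.mul_apply, hpB, hqB, smul_smul, Units.val_mul]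
  one_mem' := ⟨(centralizerGroup A).one_mem, (centralizerGroup B).one_mem, 1,
    fun _ _ ↦ by rw [Units.val_one, one_smul]; rfl, fun _ _ ↦ by rw [Units.val_one, one_smul]; rfl⟩
  inv_mem' := by
    rintro p ⟨hp₁, hp₂, c, hpA, hpB⟩
    refine ⟨(centralizerGroup A).inv_mem hp₁, (centralizerGroup B).inv_mem hp₂, c⁻¹, fun a a' ↦ ?_, fun b b' ↦ ?_⟩
    · have e := hpA (p.1⁻¹ a) (p.1⁻¹ a')
      rw [LinearEquiv.coe_inv, LinearEquiv.apply_symm_apply, LinearEquiv.apply_symm_apply] at e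
      rw [Prod.fst_inv, LinearEquiv.coe_inv, e, smul_smul, Units.inv_mul, one_smul]
    · have e := hpB (p.2⁻¹ b) (p.2⁻¹ b')
      rw [LinearEquiv.coe_inv, LinearEquiv.apply_symm_apply, LinearEquiv.apply_symm_apply] at e
      rw [Prod.snd_inv, LinearEquiv.coe_inv, e, smul_smul, Units.inv_mul, one_smul]

variable {A B hA hB}

/-- Membership in the fibre product `G(A) ×_{𝔾_m} G(B)`, unfolded. [cite: Milne1999LefschetzClasses, Def. 4.6] -/
theorem mem_similitudeCentralizerGroupFibreProd_iff
    {p : (complexBetti A.X 1 ≃ₗ[ℂ] complexBetti A.X 1) × (complexBetti B.X 1 ≃ₗ[ℂ] complexBetti B.X 1)} :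
    p ∈ similitudeCentralizerGroupFibreProd A B hA hB ↔ p.1 ∈ centralizerGroup A ∧ p.2 ∈ centralizerGroup B ∧
      ∃ c : ℂˣ,
        (∀ a a' : complexBetti A.X 1, polarizationPairingOne A.X hA (A.dim - 1) (p.1 a) (p.1 a') =
          (c : ℂ) • polarizationPairingOne A.X hA (A.dim - 1) a a') ∧
        (∀ b b' : complexBetti B.X 1, polarizationPairingOne B.X hB (B.dim - 1) (p.2 b) (p.2 b') =
          (c : ℂ) • polarizationPairingOne B.X hB (B.dim - 1) b b') :=
  Iff.rfl

/-- The fibre product projects into `G(A) × G(B)`. [cite: Milne1999LefschetzClasses, Def. 4.6] -/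
theorem similitudeCentralizerGroupFibreProd_le_prod :
    similitudeCentralizerGroupFibreProd A B hA hB ≤
      (similitudeCentralizerGroup A hA).prod (similitudeCentralizerGroup B hB) := by
  rintro p ⟨hp₁, hp₂, c, hcA, hcB⟩
  exact Subgroup.mem_prod.2 ⟨⟨hp₁, c, hcA⟩, ⟨hp₂, c, hcB⟩⟩

/-- `S(A) × S(B)` sits inside the fibre product (common multiplier `1`). [cite: Milne1999LefschetzClasses, Def. 4.6 and p. 659] -/
theorem prod_unitaryCentralizerGroup_le_similitudeCentralizerGroupFibreProd :
    (unitaryCentralizerGroup A hA).prod (unitaryCentralizerGroup B hB) ≤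
      similitudeCentralizerGroupFibreProd A B hA hB := by
  rintro p hp
  obtain ⟨⟨hp₁, hQA⟩, ⟨hp₂, hQB⟩⟩ := Subgroup.mem_prod.1 hp
  exact ⟨hp₁, hp₂, 1, fun a a' ↦ by rw [Units.val_one, one_smul]; exact hQA a a',
    fun b b' ↦ by rw [Units.val_one, one_smul]; exact hQB b b'⟩

variable (A B hA hB)

/-- **Milne 1999 Prop. 1.5 / Cor. 4.7 (kernel of `l`), binary case, on `H¹`:
`S(A × B)(ℂ) ≅ S(A)(ℂ) × S(B)(ℂ)`** for abelian varieties with `Hom(A, B) = 0 = Hom(B, A)` (no common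
isogeny factor) and the product polarization of two non-degenerate polarizations — the restriction
`u ↦ (u_A, u_B)` is an isomorphism of groups ("An isogeny `A → ∏ Aᵢ^{rᵢ}` with the `Aᵢ` simple and
pairwise nonisogenous defines an isomorphism `S(A₁) × ⋯ × S(A_s) → S(A)`"; here `s = 2`, `r₁ = r₂ = 1`,
identity isogeny, and the hypothesis in the form Milne's proof uses it, p. 658: "if `A` and `B` are
abelian varieties with `Hom(A, B) = 0`").
[cite: Milne1999LefschetzClasses, Prop. 1.5, Cor. 4.7 and p. 658 (proof of Cor. 4.2)] -/
def unitaryCentralizerGroup.prodMulEquiv (hAB : ∀ f : A ⟶ B, f = 0) (hBA : ∀ g : B ⟶ A, g = 0)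
    (hA' : lefschetzPow hA (A.dim - 1) 2 hA ≠ 0) (hB' : lefschetzPow hB (B.dim - 1) 2 hB ≠ 0) :
    unitaryCentralizerGroup (A.prod B) (prodPolarizationClass A B hA hB) ≃*
      (unitaryCentralizerGroup A hA).prod (unitaryCentralizerGroup B hB) :=
  MulEquiv.ofBijective
    ((((centralizerGroup.restrictFstHom A B).prod (centralizerGroup.restrictSndHom A B)).comp
        (Subgroup.inclusion unitaryCentralizerGroup_le_centralizerGroup)).codRestrict _ fun u ↦
      Subgroup.mem_prod.2 ((mem_unitaryCentralizerGroup_prod_iff hA' hB'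
        (Subgroup.inclusion unitaryCentralizerGroup_le_centralizerGroup u)).1 u.2))
    ⟨fun u v huv ↦ by
        have e := congrArg Subtype.val huv
        simp only [MonoidHom.codRestrict_apply, MonoidHom.comp_apply, MonoidHom.prod_apply, Prod.mk.injEq] at e
        have e' := centralizerGroup.eq_of_restrictHom_eq e.1 e.2
        exact Subgroup.inclusion_injective _ e',
      fun st ↦ by
        obtain ⟨⟨hs, -⟩, ⟨ht, -⟩⟩ := Subgroup.mem_prod.1 st.2
        obtain ⟨u, hu₁, hu₂⟩ := centralizerGroup.exists_restrictHom_eq hAB hBA hs ht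
        have hu : (u : complexBetti (A.prod B).X 1 ≃ₗ[ℂ] complexBetti (A.prod B).X 1) ∈
            unitaryCentralizerGroup (A.prod B) (prodPolarizationClass A B hA hB) := by
          refine (mem_unitaryCentralizerGroup_prod_iff hA' hB' u).2 ?_
          rw [hu₁, hu₂]
          exact Subgroup.mem_prod.1 st.2
        have hinc : Subgroup.inclusion unitaryCentralizerGroup_le_centralizerGroup
            (⟨(u : complexBetti (A.prod B).X 1 ≃ₗ[ℂ] complexBetti (A.prod B).X 1), hu⟩ :
              unitaryCentralizerGroup (A.prod B) (prodPolarizationClass A B hA hB)) = u :=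
          Subtype.ext rfl
        refine ⟨⟨u, hu⟩, Subtype.ext (Prod.ext ?_ ?_)⟩
        · change centralizerGroup.restrictFstHom A B
              (Subgroup.inclusion unitaryCentralizerGroup_le_centralizerGroup ⟨_, hu⟩) = _
          rw [hinc]
          exact hu₁
        · change centralizerGroup.restrictSndHom A B
              (Subgroup.inclusion unitaryCentralizerGroup_le_centralizerGroup ⟨_, hu⟩) = _
          rw [hinc]
          exact hu₂⟩

/-- **Milne 1999 Cor. 4.7 with Def. 4.6, binary case, on `H¹`:
`(G(A × B), l) ≅ (G(A), l) × (G(B), l)` — `G(A × B)(ℂ)` is the fibre product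
`G(A)(ℂ) ×_{ℂ^×} G(B)(ℂ)`** for abelian varieties with `Hom(A, B) = 0 = Hom(B, A)` and the product
polarization of two non-degenerate polarizations: `u ↦ (u_A, u_B)` is an isomorphism onto the pairs
with a common multiplier. (With Thm. 4.4, `G ≅ L`, this is "an isomorphism
`(L(A), l(A)) → ∏ (L(Aᵢ), l(Aᵢ))`".) [cite: Milne1999LefschetzClasses, Def. 4.6, Cor. 4.7 and Thm. 4.4] -/
def similitudeCentralizerGroup.prodMulEquiv (hAB : ∀ f : A ⟶ B, f = 0) (hBA : ∀ g : B ⟶ A, g = 0)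
    (hA' : lefschetzPow hA (A.dim - 1) 2 hA ≠ 0) (hB' : lefschetzPow hB (B.dim - 1) 2 hB ≠ 0) :
    similitudeCentralizerGroup (A.prod B) (prodPolarizationClass A B hA hB) ≃*
      similitudeCentralizerGroupFibreProd A B hA hB :=
  MulEquiv.ofBijective
    ((((centralizerGroup.restrictFstHom A B).prod (centralizerGroup.restrictSndHom A B)).comp
        (Subgroup.inclusion similitudeCentralizerGroup_le_centralizerGroup)).codRestrict _ fun u ↦
      mem_similitudeCentralizerGroupFibreProd_iff.2
        ⟨centralizerGroup.restrictFstHom_mem _, centralizerGroup.restrictSndHom_mem _,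
          (mem_similitudeCentralizerGroup_prod_iff hA' hB'
            (Subgroup.inclusion similitudeCentralizerGroup_le_centralizerGroup u)).1 u.2⟩)
    ⟨fun u v huv ↦ by
        have e := congrArg Subtype.val huv
        simp only [MonoidHom.codRestrict_apply, MonoidHom.comp_apply, MonoidHom.prod_apply, Prod.mk.injEq] at e
        have e' := centralizerGroup.eq_of_restrictHom_eq e.1 e.2
        exact Subgroup.inclusion_injective _ e',
      fun st ↦ by
        obtain ⟨hs, ht, hc⟩ := st.2
        obtain ⟨u, hu₁, hu₂⟩ := centralizerGroup.exists_restrictHom_eq hAB hBA hs ht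
        have hu : (u : complexBetti (A.prod B).X 1 ≃ₗ[ℂ] complexBetti (A.prod B).X 1) ∈
            similitudeCentralizerGroup (A.prod B) (prodPolarizationClass A B hA hB) := by
          refine (mem_similitudeCentralizerGroup_prod_iff hA' hB' u).2 ?_
          rw [hu₁, hu₂]
          exact hc
        have hinc : Subgroup.inclusion similitudeCentralizerGroup_le_centralizerGroup
            (⟨(u : complexBetti (A.prod B).X 1 ≃ₗ[ℂ] complexBetti (A.prod B).X 1), hu⟩ :
              similitudeCentralizerGroup (A.prod B) (prodPolarizationClass A B hA hB)) = u :=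
          Subtype.ext rfl
        refine ⟨⟨u, hu⟩, Subtype.ext (Prod.ext ?_ ?_)⟩
        · change centralizerGroup.restrictFstHom A B
              (Subgroup.inclusion similitudeCentralizerGroup_le_centralizerGroup ⟨_, hu⟩) = _
          rw [hinc]
          exact hu₁
        · change centralizerGroup.restrictSndHom A B
              (Subgroup.inclusion similitudeCentralizerGroup_le_centralizerGroup ⟨_, hu⟩) = _
          rw [hinc]
          exact hu₂⟩

end Groups

end Literature.AlgebraicGeometry.Milne1999

end
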